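import Summits.AtomisticToContinuum.FouriersLaw.Theses.LocalOhmBV
import Summits.AtomisticToContinuum.FouriersLaw.Theorems.LocalOhmBVBoundedResponseConvergesSplitGlue

/-!
# Split-glue certification for route `LocalOhmBV` (lead c20, crux stmt-AtomisticToContinuum-9141)

`ledger route edit route-AtomisticToContinuum-LocalOhmBV --split BoundedResponseConverges --into children.json --glue-by X`
renders the two children as NEW defs in `namespace …Theses.LocalOhmBV` with the verbatim ledger signatures of
stmt-AtomisticToContinuum-12238 / stmt-AtomisticToContinuum-11749 and appends
`theorem BoundedResponseConvergesGlueBy_holds : EscapeNonOscillation → ConductanceLowerBound → BoundedResponseConverges := _root_.X`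
to `Theses/LocalOhmBV.lean`, importing `X`'s module. The landed glue `Theorems.boundedResponseConverges_of_subs` (p137843)
cannot be `X` there: its module's import closure contains `Theses.LocalOhmBV` (via the BondHeatUncertainty slot files), an
import cycle (strategist s2, `STRATEGY-CENSUS-s2-LOBV.md` §1). Lead c20 landed the forward glue in a cycle-free module
(`Theorems/LocalOhmBVBoundedResponseConvergesSplitGlue.lean`, p151459). IMPORT-CLOSURE CHECK (2026-08-17T09:4xZ, two ways):
(a) from the `import` headers of the tree, the project closure of that module has 399 modules; (b) from the Lean environment
header of a scratch file importing only that module (`run_cmd` over `(← getEnv).header.moduleNames`, farm rc 0; not publishable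
here because crux files may not execute code): 11311 modules incl. Mathlib, the `Theses` files among them being exactly
BondHeatUncertainty, BoundaryEscapeDeficit, ContactEchoEpochs, EmbeddedDrudeMourre, FeketeResistance, FeketeSeriesLaw,
FourierGreenKubo, HonestZwanzig, JunctionLocality, OddSectorIrreversibility, PhononMeanFreePath, SuperadditiveJunction —
`Theses.LocalOhmBV`, `Theses.TransferKernelPositivity`, `Theses.MatthiessenLadder` are ABSENT (no cycle on those three routes;
a cycle exactly on the twelve listed).
This scratch file emulates the gate's rendering and checks that
`X = Summit.AtomisticToContinuum.FouriersLaw.Theorems.LocalOhmBVSplitGlue.splitGlueBy_boundedResponseConverges`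
has the rendered type up to δ-unfolding. So on LocalOhmBV the staged split is the ONE-step command

```
ledger route edit route-AtomisticToContinuum-LocalOhmBV \\
  --split BoundedResponseConverges --into children.json \\
  --glue-by Summit.AtomisticToContinuum.FouriersLaw.Theorems.LocalOhmBVSplitGlue.splitGlueBy_boundedResponseConverges \\
  --note 'strategists s1/s2 + lead c20 (crux 9141): exact two-piece split of import slot #4 into 12238 ∧ 11749 (existing items, dedup attaches); glue landed p151459 (cycle-free carrier of p137843); converse mod BoundedResponse 10924 landed (p137843)'
```

(children.json = strategist s2's attachment on stmt-9141, statements byte-equal to the live signatures of 12238 / 11749),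
superseding the two-step `--glue '<informal>'` of `SPLIT-PROPOSAL-s2.md` item 4. The same `X` serves TransferKernelPositivity and
MatthiessenLadder; for OddSectorIrreversibility no cycle-free carrier exists (the identity `responseCoeff_eq_escapeDeficit` lives in
a module importing that route file), so item 3 of the proposal (two-step) stands there.
-/

namespace Summit.AtomisticToContinuum.FouriersLaw.Cruxes.BoundedResponseConverges.SplitCertLocalOhmBV

/-- verbatim ledger signature of stmt-AtomisticToContinuum-12238 (as the gate would render the child) -/
def EscapeNonOscillation : Prop :=
  ∀ ω₂ lam β γ : ℝ, 0 < ω₂ → 0 < lam → 0 < β → 0 < γ → ∀ T : ℝ, 0 < T → (let P := Literature.MathematicalPhysics.KineticTheory.HeatConduction.pinnedChain ω₂ lam β γ; let K : ℕ → ℝ → ℝ := fun N u => if h : 0 < N then ∫ z, ((z.2 ⟨0, h⟩) ^ 2 - T) * (∫ y, ((y.2 ⟨0, h⟩) ^ 2 - T) ∂(P.transitionKernel N T T u.toNNReal z)) ∂(P.gibbsMeasure N T) else 0; let E : ℕ → ℝ := fun N => 1 - γ / T ^ 2 * ∫ u in Set.Ioi (0 : ℝ), K N u; ∃ ℓ :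 EReal, Filter.Tendsto (fun N : ℕ => ((((N : ℝ) - 1) * γ * E N : ℝ) : EReal)) Filter.atTop (nhds ℓ))

/-- verbatim ledger signature of stmt-AtomisticToContinuum-11749 (as the gate would render the child) -/
def ConductanceLowerBound : Prop :=
  ∀ ω₂ lam β γ : ℝ, 0 < ω₂ → 0 < lam → 0 < β → 0 < γ → (∀ (N : ℕ) (T_L T_R : ℝ), 0 < T_L → 0 < T_R → ∀ μ ν : MeasureTheory.Measure (Literature.MathematicalPhysics.KineticTheory.HeatConduction.PhaseSpace N), (Literature.MathematicalPhysics.KineticTheory.HeatConduction.pinnedChain ω₂ lam β γ).IsSteadyState N T_L T_R μ → (Literature.MathematicalPhysics.KineticTheory.HeatConduction.pinnedChain ω₂ lam β γ).IsSteadyState N T_L T_R ν → μ = ν) → ∀ μ : (N : ℕ) → ℝ → ℝ → MeasureTheory.Measure (Literature.MathematicalPhysics.KineticTheory.HeatConduction.PhaseSpace N), (∀ (N : ℕ) (T_L T_R : ℝ), 0 < T_L → 0 < T_R → (Literature.MathematicalPhysics.KineticTheory.HeatConduction.pinnedChain ω₂ lam β γ).IsSteadyState N T_L T_R (μ N T_L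 T_R)) → ∀ T : ℝ, 0 < T → ∀ D : ℕ → ℝ, (∀ N : ℕ, Filter.Tendsto (fun δ : ℝ => (Literature.MathematicalPhysics.KineticTheory.HeatConduction.pinnedChain ω₂ lam β γ).totalCurrent (μ N (T + δ / 2) (T - δ / 2)) / δ) (nhdsWithin 0 {(0 : ℝ)}ᶜ) (nhds (D N))) → ∃ c : ℝ, 0 < c ∧ ∃ N₁ : ℕ, ∀ N : ℕ, N₁ ≤ N → c ≤ D N

/-- the rendered children are definitionally the items' route decls -/
example : EscapeNonOscillation ↔ Summit.AtomisticToContinuum.FouriersLaw.Theses.BoundaryEscapeDeficit.EscapeNonOscillation := Iff.rfl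
example : ConductanceLowerBound ↔ Summit.AtomisticToContinuum.FouriersLaw.Theses.JunctionLocality.ConductanceLowerBound := Iff.rfl

/-- the parent: the LocalOhmBV twin unfolds to the glue theorem's written-out conclusion -/
example : Summit.AtomisticToContinuum.FouriersLaw.Theses.LocalOhmBV.BoundedResponseConverges ↔
    Summit.AtomisticToContinuum.FouriersLaw.Theses.OddSectorIrreversibility.BoundedResponseConverges := Iff.rfl

/-- `--glue-by` on route LocalOhmBV: the rendered glue theorem, closed by the landed cycle-free carrier (p151459). -/
theorem glueBy_localOhmBV :
    EscapeNonOscillation → ConductanceLowerBound →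
      Summit.AtomisticToContinuum.FouriersLaw.Theses.LocalOhmBV.BoundedResponseConverges :=
  Summit.AtomisticToContinuum.FouriersLaw.Theorems.LocalOhmBVSplitGlue.splitGlueBy_boundedResponseConverges

/-- the same term over the items' route decls by name (the shape `boundedResponseConverges_of_subs` has on OSI) -/
theorem glueBy_localOhmBV_byName :
    Summit.AtomisticToContinuum.FouriersLaw.Theses.BoundaryEscapeDeficit.EscapeNonOscillation →
      Summit.AtomisticToContinuum.FouriersLaw.Theses.JunctionLocality.ConductanceLowerBound →
        Summit.AtomisticToContinuum.FouriersLaw.Theses.LocalOhmBV.BoundedResponseConverges :=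
  Summit.AtomisticToContinuum.FouriersLaw.Theorems.LocalOhmBVSplitGlue.splitGlueBy_boundedResponseConverges

#print axioms glueBy_localOhmBV

end Summit.AtomisticToContinuum.FouriersLaw.Cruxes.BoundedResponseConverges.SplitCertLocalOhmBV
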